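import Summits.AtomisticToContinuum.FouriersLaw.Theorems.BondHeatUncertaintyExtensiveSnapshotIrreversibilityEnergyWindowDivergenceAtoms

/-!
# Crux `ExtensiveSnapshotIrreversibility` (stmt-AtomisticToContinuum-9121), fixed-`N` half `K_fix`:
the DIVERGENCE LADDER — the rung QMD₀ beneath ΔSharp, and A4 above it
(node «DivergenceLadder», 4/6)

(statement + glue file, theorem-side; decomp-a2c lens-1 «grading / quantitative ladder», gen 89.)

The second-order atom ΔSharp `NessFlipTriangularSharp` of `…EnergyWindowDivergenceAtoms` sits at
the bottom of the classical ladder of linear-response regularity: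

  A4 `NessLinearResponseL2`  (the density ratio `f_δ = dμ_δ/dμ_T` is `L²(μ_T)`-differentiable at
      `δ = 0`)  ⟹  QMD₀ `NessSqrtResponseL2`  (Le Cam's DIFFERENTIABILITY IN QUADRATIC MEAN:
      `√f_δ` is `L²(μ_T)`-differentiable at `δ = 0`; no second moment of the response is asked)
      ⟹  ΔSharp  (given the reweighting A0 — file `…EnergyWindowDivergenceHalfExp`).

This file: the definition of QMD₀ and the upper rung.
* `sqrt_dq_sq_le` — the scalar inequality behind A4 ⟹ QMD₀:
  `((s−1)/δ − g/2)² ≤ 2A² + (g² − n/2)⁺ + n δ² (A² + g²)`, `A = (s²−1)/δ − g`, `s ≥ 0`;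
* `nessSqrtResponseL2_of_linearResponseL2` — **A4 ⟹ QMD₀** with `g = g₀/2` (dominated
  convergence for the soft truncation `(g₀² − n/2)⁺`, then `δ → 0`).

No new objects. [folklore]  References: L. Le Cam, Asymptotic Methods in Statistical Decision
Theory (1986) §17.3 (DQM); A. W. van der Vaart, Asymptotic Statistics (1998) §7.2.
-/

noncomputable section

namespace Summit.AtomisticToContinuum.FouriersLaw.Theorems.ExtensiveSnapshotIrreversibility.EnergyWindow

open MeasureTheory Filter Topology InformationTheory Real
open scoped ENNReal NNReal
open Literature.MathematicalPhysics.KineticTheory.HeatConduction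
open Summit.AtomisticToContinuum.FouriersLaw.Theorems.ExtensiveSnapshotIrreversibility.Negative
open Summit.AtomisticToContinuum.FouriersLaw.Theorems.ExtensiveSnapshotIrreversibility.ClausiusBudget.OddLogDensity

variable {N : ℕ}

/-! ## 1. The rung QMD₀ -/

/-- **QMD₀ `NessSqrtResponseL2` (differentiability in quadratic mean of the steady states at
`δ = 0`)**: along every steady-state family of the pinned chain (under weak-NESS uniqueness), for
`T > 0`, `N ≥ 2`, there is `g ∈ L²(μ_T)` with
`∫ ((√(dμ_{N,T+δ/2,T−δ/2}/dμ_T) − 1)/δ − g)² dμ_T → 0` as `δ → 0`, `δ ≠ 0` (Le Cam; the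
Radon–Nikodym derivative of the a.c. part, a probability density near `δ = 0`, so the integrand is
in
`L¹(μ_T)` and no junk value occurs). [route statement · this cell; NOT a literature fact] -/
def NessSqrtResponseL2 : Prop :=
  ∀ ω₂ lam β γ : ℝ, 0 < ω₂ → 0 < lam → 0 < β → 0 < γ →
    (∀ (N : ℕ) (T_L T_R : ℝ), 0 < T_L → 0 < T_R → ∀ μ ν : Measure (PhaseSpace N),
      (pinnedChain ω₂ lam β γ).IsSteadyState N T_L T_R μ →
      (pinnedChain ω₂ lam β γ).IsSteadyState N T_L T_R ν → μ = ν) →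
    ∀ μ : (N : ℕ) → ℝ → ℝ → Measure (PhaseSpace N),
      (∀ (N : ℕ) (T_L T_R : ℝ), 0 < T_L → 0 < T_R →
        (pinnedChain ω₂ lam β γ).IsSteadyState N T_L T_R (μ N T_L T_R)) →
      ∀ T : ℝ, 0 < T → ∀ N : ℕ, 2 ≤ N →
        ∃ g : PhaseSpace N → ℝ, MemLp g 2 ((pinnedChain ω₂ lam β γ).gibbsMeasure N T) ∧
          Tendsto (fun δ : ℝ => ∫ x, ((Real.sqrt (((μ N (T + δ / 2) (T - δ / 2)).rnDeriv
              ((pinnedChain ω₂ lam β γ).gibbsMeasure N T) x).toReal) - 1) / δ - g x) ^ 2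
            ∂(pinnedChain ω₂ lam β γ).gibbsMeasure N T) (𝓝[≠] (0 : ℝ)) (𝓝 0)

/-! ## 2. A4 ⟹ QMD₀ -/

/-- The scalar inequality: for `s ≥ 0`, `δ ≠ 0`, `n ≥ 0` and `A := (s² − 1)/δ − g`,
`((s − 1)/δ − g/2)² ≤ 2A² + (g² − n/2)⁺ + n δ² (A² + g²)`
(`(s−1)/δ − g/2 = (A + (g/2)(1 − s))/(1 + s)`, `((1−s)/(1+s))² ≤ min(1, (1 − s²)²)`,
`1 − s² = −δ(A + g)`). [folklore] -/
theorem sqrt_dq_sq_le {s δ g n : ℝ} (hs : 0 ≤ s) (hδ : δ ≠ 0) (hn : 0 ≤ n) :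
    ((s - 1) / δ - g / 2) ^ 2 ≤ 2 * ((s ^ 2 - 1) / δ - g) ^ 2 + max (g ^ 2 - n / 2) 0 +
      n * δ ^ 2 * (((s ^ 2 - 1) / δ - g) ^ 2 + g ^ 2) := by
  set A : ℝ := (s ^ 2 - 1) / δ - g with hA
  have h1s : 0 < 1 + s := by linarith
  have hkey : (s - 1) / δ - g / 2 = (A + g / 2 * (1 - s)) / (1 + s) := by
    rw [hA]
    field_simp
    ring
  have hsq : ((s - 1) / δ - g / 2) ^ 2 ≤ 2 * A ^ 2 + g ^ 2 / 2 * ((1 - s) / (1 + s)) ^ 2 := by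
    rw [hkey, div_pow]
    have hnum : (A + g / 2 * (1 - s)) ^ 2 ≤ 2 * A ^ 2 + g ^ 2 / 2 * (1 - s) ^ 2 := by
      nlinarith [sq_nonneg (A - g / 2 * (1 - s))]
    have hden : 1 ≤ (1 + s) ^ 2 := by nlinarith
    calc (A + g / 2 * (1 - s)) ^ 2 / (1 + s) ^ 2
        ≤ (2 * A ^ 2 + g ^ 2 / 2 * (1 - s) ^ 2) / (1 + s) ^ 2 :=
          div_le_div_of_nonneg_right hnum (by positivity)
      _ = 2 * A ^ 2 / (1 + s) ^ 2 + g ^ 2 / 2 * ((1 - s) / (1 + s)) ^ 2 := by rw [div_pow]; ring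
      _ ≤ 2 * A ^ 2 + g ^ 2 / 2 * ((1 - s) / (1 + s)) ^ 2 := by
          have : 2 * A ^ 2 / (1 + s) ^ 2 ≤ 2 * A ^ 2 := div_le_self (by positivity) hden
          linarith
  have hr1 : ((1 - s) / (1 + s)) ^ 2 ≤ 1 := by
    rw [div_pow, div_le_one (by positivity)]
    nlinarith
  have hr2 : ((1 - s) / (1 + s)) ^ 2 ≤ 2 * δ ^ 2 * (A ^ 2 + g ^ 2) := by
    have e1 : 1 - s ^ 2 = -(δ * (A + g)) := by
      rw [hA]
      field_simp
      ring
    have h3 : ((1 - s) / (1 + s)) ^ 2 ≤ (1 - s ^ 2) ^ 2 := by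
      rw [div_pow, div_le_iff₀ (by positivity)]
      have e2 : (1 - s ^ 2) ^ 2 * (1 + s) ^ 2 = (1 - s) ^ 2 * (1 + s) ^ 4 := by ring
      rw [e2]
      have h4 : 1 ≤ (1 + s) ^ 4 := one_le_pow₀ (by linarith)
      nlinarith [sq_nonneg (1 - s)]
    calc ((1 - s) / (1 + s)) ^ 2 ≤ (1 - s ^ 2) ^ 2 := h3
      _ = δ ^ 2 * (A + g) ^ 2 := by rw [e1]; ring
      _ ≤ 2 * δ ^ 2 * (A ^ 2 + g ^ 2) := by nlinarith [sq_nonneg (A - g), sq_nonneg δ]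
  have hlast : 0 ≤ n * δ ^ 2 * (A ^ 2 + g ^ 2) := by positivity
  rcases lt_or_ge n (g ^ 2) with hcase | hcase
  · have hm : g ^ 2 / 2 ≤ max (g ^ 2 - n / 2) 0 := le_max_of_le_left (by linarith)
    nlinarith [mul_le_mul_of_nonneg_left hr1 (by positivity : 0 ≤ g ^ 2 / 2)]
  · have hm : 0 ≤ max (g ^ 2 - n / 2) 0 := le_max_right _ _
    have h5 : g ^ 2 / 2 * ((1 - s) / (1 + s)) ^ 2 ≤ n * δ ^ 2 * (A ^ 2 + g ^ 2) :=
      calc g ^ 2 / 2 * ((1 - s) / (1 + s)) ^ 2 ≤ n / 2 * (2 * δ ^ 2 * (A ^ 2 + g ^ 2)) :=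
            mul_le_mul (by linarith) hr2 (sq_nonneg _) (by positivity)
        _ = n * δ ^ 2 * (A ^ 2 + g ^ 2) := by ring
    linarith

/-- **A4 ⟹ QMD₀** (`g = g₀/2`):
`∫ ((√f_δ − 1)/δ − g₀/2)² ≤ 2 a_δ + ∫ (g₀² − n/2)⁺ + n δ² (a_δ + ∫ g₀²)`
with `a_δ = ∫ ((f_δ − 1)/δ − g₀)² → 0`; the truncation term is small for `n` large (dominated
convergence), the rest as `δ → 0`. [folklore] -/
theorem nessSqrtResponseL2_of_linearResponseL2 (h4 : NessLinearResponseL2) :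
    NessSqrtResponseL2 := by
  intro ω₂ lam β γ hω₂ hlam hβ hγ hU μ hμ T hT N hN
  obtain ⟨δ₄, hδ₄, g₀, hg₀, hB2m, hB2t⟩ := h4 ω₂ lam β γ hω₂ hlam hβ hγ hU μ hμ T hT N hN
  set P := pinnedChain ω₂ lam β γ with hP
  set μT := P.gibbsMeasure N T with hμT
  haveI hprob : IsProbabilityMeasure μT :=
    pinnedChain_isProbabilityMeasure_gibbsMeasure hω₂ hlam.le hβ.le γ N hT
  refine ⟨fun x => g₀ x / 2, MemLp.ae_eq (ae_of_all _ fun x => by ring) (hg₀.const_mul (1 / 2)), ?_⟩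
  -- names
  set f : ℝ → PhaseSpace N → ℝ := fun δ x => (((μ N (T + δ / 2) (T - δ / 2)).rnDeriv μT) x).toReal
    with hf
  have hf0 : ∀ δ x, 0 ≤ f δ x := fun δ x => ENNReal.toReal_nonneg
  set a : ℝ → ℝ := fun δ => ∫ x, ((f δ x - 1) / δ - g₀ x) ^ 2 ∂μT with ha
  have hat : Tendsto a (𝓝[≠] (0 : ℝ)) (𝓝 0) := hB2t
  set G₀ : ℝ := ∫ x, g₀ x ^ 2 ∂μT with hG₀
  have hg2 : Integrable (fun x => g₀ x ^ 2) μT := hg₀.integrable_sq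
  -- the soft truncation `(g₀² − n/2)⁺`
  set F : ℕ → PhaseSpace N → ℝ := fun n x => max (g₀ x ^ 2 - n / 2) 0 with hF
  have hF0 : ∀ n x, 0 ≤ F n x := fun n x => le_max_right _ _
  have hFle : ∀ n x, F n x ≤ g₀ x ^ 2 := fun n x =>
    max_le (by linarith [Nat.cast_nonneg (α := ℝ) n]) (sq_nonneg _)
  have hFm : ∀ n, AEStronglyMeasurable (F n) μT := fun n =>
    ((continuous_id.sub continuous_const).max continuous_const).comp_aestronglyMeasurable
      (hg₀.aestronglyMeasurable.pow 2)
  have hFb : ∀ n, ∀ᵐ x ∂μT, ‖F n x‖ ≤ g₀ x ^ 2 := fun n => ae_of_all _ fun x => by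
    rw [Real.norm_eq_abs, abs_of_nonneg (hF0 n x)]
    exact hFle n x
  have hFi : ∀ n, Integrable (F n) μT := fun n => hg2.mono' (hFm n) (hFb n)
  have hFlim : Tendsto (fun n => ∫ x, F n x ∂μT) atTop (𝓝 0) := by
    have h := tendsto_integral_of_dominated_convergence (fun x => g₀ x ^ 2) hFm hg2 hFb
      (f := fun _ => 0) (ae_of_all _ fun x => ?_)
    · simpa using h
    obtain ⟨n₀, hn₀⟩ := exists_nat_ge (2 * g₀ x ^ 2)
    refine tendsto_atTop_of_eventually_const (i₀ := n₀) fun n hn => ?_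
    have hn' : (n₀ : ℝ) ≤ n := Nat.cast_le.2 hn
    exact max_eq_right (by linarith)
  rw [Metric.tendsto_nhds]
  intro ε hε
  obtain ⟨n, hn⟩ := ((Metric.tendsto_nhds.1 hFlim) (ε / 4) (by positivity)).exists
  have hn' : ∫ x, F n x ∂μT < ε / 4 := by
    rw [Real.dist_eq, sub_zero, abs_of_nonneg (integral_nonneg (hF0 n))] at hn
    exact hn
  -- smallness in `δ`
  have ht : Tendsto (fun δ : ℝ => 2 * a δ + n * δ ^ 2 * (a δ + G₀)) (𝓝[≠] (0 : ℝ)) (𝓝 0) := by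
    have hδ2 : Tendsto (fun δ : ℝ => δ ^ 2) (𝓝[≠] (0 : ℝ)) (𝓝 0) := by
      have h : Tendsto (fun δ : ℝ => δ ^ 2) (𝓝 (0 : ℝ)) (𝓝 ((0 : ℝ) ^ 2)) :=
        (continuous_pow 2).tendsto 0
      rw [zero_pow two_ne_zero] at h
      exact h.mono_left nhdsWithin_le_nhds
    have h := (hat.const_mul 2).add ((hδ2.const_mul (n : ℝ)).mul (hat.add_const G₀))
    simpa using h
  have hev := (Metric.tendsto_nhds.1 ht) (ε / 2) (by positivity)
  filter_upwards [hev, eventually_ne_and_abs_lt hδ₄] with δ hδε hδ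
  have hAδ : MemLp (fun x => (f δ x - 1) / δ - g₀ x) 2 μT := (hB2m δ hδ.1 hδ.2).sub hg₀
  have hA2 : Integrable (fun x => ((f δ x - 1) / δ - g₀ x) ^ 2) μT := hAδ.integrable_sq
  have hBi : Integrable (fun x => 2 * ((f δ x - 1) / δ - g₀ x) ^ 2 + F n x +
      n * δ ^ 2 * (((f δ x - 1) / δ - g₀ x) ^ 2 + g₀ x ^ 2)) μT :=
    ((hA2.const_mul 2).add (hFi n)).add ((hA2.add hg2).const_mul _)
  have hpt : ∀ x, ((Real.sqrt (f δ x) - 1) / δ - g₀ x / 2) ^ 2 ≤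
      2 * ((f δ x - 1) / δ - g₀ x) ^ 2 + F n x +
        n * δ ^ 2 * (((f δ x - 1) / δ - g₀ x) ^ 2 + g₀ x ^ 2) := by
    intro x
    have h := sqrt_dq_sq_le (g := g₀ x) (Real.sqrt_nonneg (f δ x)) hδ.1 (Nat.cast_nonneg n)
    rw [Real.sq_sqrt (hf0 δ x)] at h
    exact h
  have hint : ∫ x, ((Real.sqrt (f δ x) - 1) / δ - g₀ x / 2) ^ 2 ∂μT ≤
      2 * a δ + ∫ x, F n x ∂μT + n * δ ^ 2 * (a δ + G₀) := by
    refine (integral_mono_of_nonneg (ae_of_all _ fun x => sq_nonneg _) hBi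
      (ae_of_all _ hpt)).trans (le_of_eq ?_)
    have h1 : Integrable (fun x => 2 * ((f δ x - 1) / δ - g₀ x) ^ 2 + F n x) μT :=
      (hA2.const_mul 2).add (hFi n)
    have h2 : Integrable (fun x => n * δ ^ 2 * (((f δ x - 1) / δ - g₀ x) ^ 2 + g₀ x ^ 2)) μT :=
      (hA2.add hg2).const_mul _
    have h3 : Integrable (fun x => 2 * ((f δ x - 1) / δ - g₀ x) ^ 2) μT := hA2.const_mul 2
    rw [integral_add h1 h2, integral_add h3 (hFi n), integral_const_mul, integral_const_mul,
      integral_add hA2 hg2]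
  rw [Real.dist_eq, sub_zero] at hδε
  have h3 := (abs_lt.1 hδε).2
  rw [Real.dist_eq, sub_zero, abs_of_nonneg (integral_nonneg fun x => sq_nonneg _)]
  change ∫ x, ((Real.sqrt (f δ x) - 1) / δ - g₀ x / 2) ^ 2 ∂μT < ε
  linarith

end Summit.AtomisticToContinuum.FouriersLaw.Theorems.ExtensiveSnapshotIrreversibility.EnergyWindow

end
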